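import Literature.NumberTheory.EllipticCurves.ModularDegreeFormula
import Literature.NumberTheory.EllipticCurves.ModularDegreeFormulaDomainProofs
import Literature.NumberTheory.EllipticCurves.ModularCurveManinConstantProofs
import Literature.NumberTheory.EllipticCurves.ModularSymbolsLattice
import Literature.Analysis.Calculus.AreaFormulaMultiplicity
import Mathlib.Algebra.Module.ZLattice.Covolume
import Mathlib.RingTheory.Complex
import HarnessLib

/-!
# Zagier's degree formula `4π² c² (f, f) = deg(φ) · covol(Λ_E)`: proof of `zagier_degree_formula`

This file discharges, sorry-free, the named fact
`Literature.NumberTheory.EllipticCurves.ModularForms.ModularParametrizationData.zagier_degree_formula`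
of `Literature/NumberTheory/EllipticCurves/ModularDegreeFormula.lean`
(`ModularParametrizationData.zagier_degree_formula_holds`): for every modular parametrisation
datum `D` of a Weierstrass curve `W/ℚ` at level `N` — newform `f`, Néron lattice `Λ_E = D.L.lattice`,
Manin constant `c`, `φ(τ) = uniformize (c · 2πi ∫_{i∞}^τ f)`, modular degree `deg` —

`4π² c² (f, f)_{Γ₀(N)} = deg(φ) · covol(Λ_E)`,

with `(f, f) = peterssonProduct (Gamma0 N) 2 f f` (no volume normalisation) and
`covol(Λ_E) = ZLattice.covolume D.L.lattice` (Lebesgue measure on `ℂ`). It is used, through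
`Literature.NumberTheory.EllipticCurves.gross_zagier_of_explicit`, to pass between the printed
normalisation of the Gross–Zagier formula (Cai–Shu–Tian 2014, Thm. 1.1: `8π²(φ,φ)/deg f`) and the
period normalisation `‖ω‖²/c²` of `Literature.NumberTheory.EllipticCurves.gross_zagier`.

## The printed proof and this file

Zagier (*Modular parametrizations of elliptic curves*, Canad. Math. Bull. 28 (1985), §1,
p. 374): "Assuming that `f` corresponds to a modular parametrization `φ : X → E = ℂ/Λ`, we can
relate this Petersson norm to `deg(φ)` as follows:
`‖f‖² = ∬_{Γ∖ℍ} |f|² du dv = (i/2)/(4π²) ∬_{Γ∖ℍ} φ^*(dz) ∧ φ^*(dz̄) = deg(φ)/(4π²) · (i/2) ∬_E dz ∧ dz̄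
= (1/4π²) deg(φ) Vol(E)`, where `Vol(E)` is the area of a fundamental period parallelogram for the
lattice `Λ`." (Zagier's `f` is our `c · f`: `φ^*(dz) = c · 2πi f(τ) dτ`.) The middle equality is
the change of variables for the branched covering `φ` of degree `deg(φ)`. Mathlib has neither
`X₀(N)` as a Riemann surface nor the degree of a holomorphic map, so, as for the existence of the
degree (`ModularParametrizationDegreeProofs.lean`), the argument is carried out on `ℍ ⊆ ℂ`:

1. *The Petersson norm as an area integral* (`ModularDegreeFormulaDomainProofs.lean`):
   `(f, f) = ∬_F |f|² dx dy` for the fundamental domain `F = ⋃_q g_q⁻¹ 𝒟ᵒ` of `Γ₀(N)` built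
   from coset representatives `g_q ∈ SL(2, ℤ)` (Diamond–Shurman §5.4).
2. *The area formula* (`lintegral_domain_eq_lintegral_encard`): with `Ψ = c · 2πi ∫_{i∞}^τ f`,
   holomorphic with `Ψ' = c · 2πi f` (`hasDerivAt_eichlerIntegral`), real Jacobian
   `|Ψ'|² = 4π²c²|f|²` (`det_restrictScalars_toSpanSingleton`, `norm_maninConstant_mul_sq`) and
   locally injective off the zeros of `f` (inverse function theorem, `exists_injOn_and_nhds_le_map`;
   `c ≠ 0` by `maninConstant_ne_zero_holds`), the area formula with multiplicity
   (`Literature.Analysis.Calculus.lintegral_abs_det_fderiv_eq_lintegral_encard`; Evans–Gariepy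
   Thm. 3.8, Federer 3.2.3) gives `4π²c² ∬_F |f|² dx dy = ∫_ℂ #{z ∈ F ∖ {f = 0} : Ψ(z) = y} dy`
   (the zeros of `f` are a null set of `F` on which the integrand vanishes).
3. *Counting* (`ae_tsum_encard_fiber_eq_deg`): for a.e. `w ∈ ℂ`,
   `∑_{λ ∈ Λ_E} #{z ∈ F ∖ {f=0} : Ψ(z) = λ + w} = deg(φ)`. Indeed `deg_spec` says that off finitely
   many points of `E(ℂ) = ℂ/Λ_E` (`ker uniformize = Λ_E`) the fibre `{Γ₀(N)τ : Ψ(τ) ≡ w mod Λ_E}`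
   has exactly `deg` orbits (`natCard_fiber_eq_deg`; the exceptional `w` form finitely many cosets
   of the countable `Λ_E`, `countable_preimage_uniformize`); each orbit meets `F` in exactly one
   point (`encard_fiber_inter_domain_eq_deg`) unless it meets the boundary translates
   `SL(2, ℤ) · (𝒟 ∖ 𝒟ᵒ)`, a hyperbolically null set whose image under `Ψ` translated by `Λ_E` is
   Lebesgue null (`volume_setOf_exists_sub_mem_eq_zero`, Mathlib
   `addHaar_image_eq_zero_of_differentiableOn_of_addHaar_eq_zero`); and the zeros of `f ≠ 0` are
   countable (`countable_setOf_cuspForm_eq_zero`).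
4. *Tiling* (`lintegral_eq_mul_covolume_of_tsum_eq`): integrating over a fundamental parallelogram
   of `Λ_E` (Mathlib `IsAddFundamentalDomain.lintegral_eq_tsum''`,
   `ZLattice.covolume_eq_measure_fundamentalDomain`),
   `∫_ℂ #{…} dy = deg(φ) · covol(Λ_E)`; hence `4π²c²(f, f) = deg(φ) covol(Λ_E)`
   (`zagier_degree_formula_of_cosetReps`, `ModularParametrizationData.zagier_degree_formula_holds`).

No new definitions are made.

## References

* D. Zagier, *Modular parametrizations of elliptic curves*, Canad. Math. Bull. 28 (1985),
  372–384: §1, p. 374. doi:10.4153/CMB-1985-044-8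
* F. Diamond, J. Shurman, *A First Course in Modular Forms*, GTM 228, Springer 2005: §2.3–2.4,
  §5.4, §6.6.
* L. C. Evans, R. F. Gariepy, *Measure Theory and Fine Properties of Functions*, revised ed.,
  CRC Press 2015: Thm. 3.8 (area formula).
* J. E. Cremona, *Algorithms for modular elliptic curves*, 2nd ed., CUP 1997: §2.10.
-/

noncomputable section

open scoped MatrixGroups ModularForm Modular Topology ENNReal NNReal
open MeasureTheory Filter Set Function ModularGroup CongruenceSubgroup
open UpperHalfPlane hiding I

namespace Literature.NumberTheory.EllipticCurves.ModularForms

/-! ### The area-formula step: `4π²c² ∫_F |f|² dx dy = ∫_ℂ #(Ψ⁻¹(y) ∩ F) dy` -/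

section AreaStep

variable {N : ℕ} [NeZero N] {W : WeierstrassCurve ℚ} (D : ModularParametrizationData W N)

/-- `Ψ = c · 2πi ∫_{i∞}^τ f` is holomorphic on `ℍ` with `Ψ' = c · 2πi f` (`hasDerivAt_eichlerIntegral`,
Cremona §2.10). [folklore] -/
theorem hasDerivAt_maninConstant_mul_eichlerIntegral {z : ℂ} (hz : 0 < z.im) :
    HasDerivAt ((fun τ : ℍ ↦ (D.c : ℂ) * eichlerIntegral D.f τ) ∘ ofComplex)
      ((D.c : ℂ) * (2 * Real.pi * Complex.I * D.f (ofComplex z))) z :=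
  (hasDerivAt_eichlerIntegral D.f hz).const_mul _

/-- The real Jacobian determinant of multiplication by `d ∈ ℂ` on `ℂ ≅ ℝ²` is `|d|²`
(Mathlib: `Algebra.norm_complex_apply`). [folklore] -/
theorem det_restrictScalars_toSpanSingleton (d : ℂ) :
    ((ContinuousLinearMap.toSpanSingleton ℂ d).restrictScalars ℝ).det = ‖d‖ ^ 2 := by
  have h1 : (((ContinuousLinearMap.toSpanSingleton ℂ d).restrictScalars ℝ : ℂ →L[ℝ] ℂ) :
      ℂ →ₗ[ℝ] ℂ) = Algebra.lmul ℝ ℂ d := by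
    ext x; simp [mul_comm]
  rw [ContinuousLinearMap.det, h1, ← Algebra.norm_apply, Algebra.norm_complex_apply,
    Complex.normSq_eq_norm_sq]

/-- `|Ψ'(τ)|² = |c · 2πi f(τ)|² = 4π² c² |f(τ)|²`. [folklore] -/
theorem norm_maninConstant_mul_sq (x : ℂ) :
    ‖(D.c : ℂ) * (2 * Real.pi * Complex.I * x)‖ ^ 2 = 4 * Real.pi ^ 2 * (D.c : ℝ) ^ 2 * ‖x‖ ^ 2 := by
  simp only [norm_mul, Complex.norm_intCast, Complex.norm_ofNat, Complex.norm_real, Real.norm_eq_abs,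
    abs_of_pos Real.pi_pos, Complex.norm_I, mul_one, mul_pow, sq_abs]
  ring

/-- `Ψ ∘ ofComplex` is real-differentiable at every point of (the image in `ℂ` of) a subset of
`ℍ`, with derivative multiplication by `Ψ'(τ) = c · 2πi f(τ)`. [folklore] -/
theorem hasFDerivWithinAt_comp_ofComplex (S : Set ℍ) :
    ∀ x ∈ ((↑) : ℍ → ℂ) '' S, HasFDerivWithinAt
      ((fun τ : ℍ ↦ (D.c : ℂ) * eichlerIntegral D.f τ) ∘ ofComplex)
      ((ContinuousLinearMap.toSpanSingleton ℂ
        ((D.c : ℂ) * (2 * Real.pi * Complex.I * D.f (ofComplex x)))).restrictScalars ℝ)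
      (((↑) : ℍ → ℂ) '' S) x := by
  rintro _ ⟨τ, -, rfl⟩
  exact ((hasDerivAt_maninConstant_mul_eichlerIntegral D τ.im_pos).hasFDerivAt.restrictScalars
    ℝ).hasFDerivWithinAt

/-- **Local injectivity of `Ψ` off the zeros of `f`** (inverse function theorem,
`exists_injOn_and_nhds_le_map`; `Ψ' = c · 2πi f` with `c ≠ 0`, `maninConstant_ne_zero_holds`).
[folklore] -/
theorem exists_injOn_nhdsWithin_comp_ofComplex {S : Set ℍ} (hS : ∀ τ ∈ S, D.f τ ≠ 0) :
    ∀ x ∈ ((↑) : ℍ → ℂ) '' S, ∃ V ∈ 𝓝[((↑) : ℍ → ℂ) '' S] x,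
      InjOn ((fun τ : ℍ ↦ (D.c : ℂ) * eichlerIntegral D.f τ) ∘ ofComplex) V := by
  rintro _ ⟨τ, hτ, rfl⟩
  have hdiff : DifferentiableOn ℂ ((fun τ : ℍ ↦ (D.c : ℂ) * eichlerIntegral D.f τ) ∘ ofComplex)
      {z : ℂ | 0 < z.im} := fun z hz ↦
    (hasDerivAt_maninConstant_mul_eichlerIntegral D hz).differentiableAt.differentiableWithinAt
  have hne : (D.c : ℂ) * (2 * Real.pi * Complex.I * D.f (ofComplex (τ : ℂ))) ≠ 0 := by
    rw [ofComplex_apply]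
    refine mul_ne_zero (Int.cast_ne_zero.mpr D.maninConstant_ne_zero_holds) (mul_ne_zero ?_ (hS τ hτ))
    simp [Real.pi_ne_zero, Complex.I_ne_zero]
  obtain ⟨⟨V, hV, hVinj⟩, -⟩ := exists_injOn_and_nhds_le_map hdiff
    (hasDerivAt_maninConstant_mul_eichlerIntegral D τ.im_pos) hne
  refine ⟨((↑) : ℍ → ℂ) '' V,
    mem_nhdsWithin_of_mem_nhds (isOpenEmbedding_coe.image_mem_nhds.mpr hV), ?_⟩
  rintro _ ⟨σ, hσ, rfl⟩ _ ⟨σ', hσ', rfl⟩ h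
  simp only [Function.comp_apply, ofComplex_apply] at h
  rw [hVinj hσ hσ' h]

variable (g : (↥𝒮ℒ ⧸ (Gamma0 N : Subgroup (GL (Fin 2) ℝ)).subgroupOf 𝒮ℒ) → SL(2, ℤ))
  (hg : ∀ q, (Matrix.SpecialLinearGroup.mapGL ℝ (g q) : GL (Fin 2) ℝ) = ((q.out : ↥𝒮ℒ) : GL (Fin 2) ℝ))

omit [NeZero N] in
/-- The domain `F = ⋃_q g_q⁻¹ 𝒟ᵒ` is open. [folklore] -/
theorem isOpen_iUnion_setOf_smul_mem_fdo : IsOpen (⋃ q, {τ : ℍ | g q • τ ∈ 𝒟ᵒ}) :=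
  isOpen_iUnion fun q ↦ isOpen_setOf_smul_mem_fdo (g q)

/-- The image in `ℂ` of `F ∖ {f = 0}` is open. [folklore] -/
theorem isOpen_image_coe_domain_inter :
    IsOpen (((↑) : ℍ → ℂ) '' ((⋃ q, {τ : ℍ | g q • τ ∈ 𝒟ᵒ}) ∩ {τ | D.f τ ≠ 0})) :=
  isOpenEmbedding_coe.isOpenMap _
    ((isOpen_iUnion_setOf_smul_mem_fdo g).inter
      (isOpen_ne_fun (ModularFormClass.continuous D.f) continuous_const))

/-- The multiplicity function `y ↦ #{z ∈ F ∖ {f = 0} : Ψ(z) = y}` is measurable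
(`Literature.Analysis.Calculus.measurable_encard_preimage_inter`). [folklore] -/
theorem measurable_encard_fiber :
    Measurable fun y : ℂ ↦ ((((fun τ : ℍ ↦ (D.c : ℂ) * eichlerIntegral D.f τ) ∘ ofComplex) ⁻¹' {y} ∩
      ((↑) : ℍ → ℂ) '' ((⋃ q, {τ : ℍ | g q • τ ∈ 𝒟ᵒ}) ∩ {τ | D.f τ ≠ 0})).encard : ℝ≥0∞) :=
  _root_.Literature.Analysis.Calculus.measurable_encard_preimage_inter
    (isOpen_image_coe_domain_inter D g).measurableSet (hasFDerivWithinAt_comp_ofComplex D _)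
    (exists_injOn_nhdsWithin_comp_ofComplex D fun _ h ↦ h.2)

/-- **The area formula applied to `Ψ` on `F ∖ {f = 0}`** (`Literature.Analysis.Calculus.
lintegral_abs_det_fderiv_eq_lintegral_encard`, i.e. Evans–Gariepy Thm. 3.8 in the locally
injective case; local injectivity of `Ψ` at the non-zeros of `f = Ψ'/(2πi c)` is the inverse
function theorem):
`4π²c² ∫_{F ∖ {f=0}} |f|² dx dy = ∫_ℂ #{z ∈ F ∖ {f = 0} : Ψ(z) = y} dy`. This is the step
"`‖f‖² = ∬ φ^*(dx dy)`, counted with the multiplicity of the covering" of Zagier 1985, §1.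
[folklore] -/
theorem lintegral_domain_eq_lintegral_encard :
    ENNReal.ofReal (4 * Real.pi ^ 2 * (D.c : ℝ) ^ 2) *
        ∫⁻ z in ((↑) : ℍ → ℂ) '' ((⋃ q, {τ : ℍ | g q • τ ∈ 𝒟ᵒ}) ∩ {τ | D.f τ ≠ 0}),
          ENNReal.ofReal (‖D.f (ofComplex z)‖ ^ 2) =
      ∫⁻ y, ((((fun τ : ℍ ↦ (D.c : ℂ) * eichlerIntegral D.f τ) ∘ ofComplex) ⁻¹' {y} ∩
        ((↑) : ℍ → ℂ) '' ((⋃ q, {τ : ℍ | g q • τ ∈ 𝒟ᵒ}) ∩ {τ | D.f τ ≠ 0})).encard : ℝ≥0∞) := by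
  have harea := _root_.Literature.Analysis.Calculus.lintegral_abs_det_fderiv_eq_lintegral_encard
    volume (isOpen_image_coe_domain_inter D g).measurableSet (hasFDerivWithinAt_comp_ofComplex D _)
    (exists_injOn_nhdsWithin_comp_ofComplex D fun _ h ↦ h.2)
  rw [← harea, ← lintegral_const_mul' _ _ ENNReal.ofReal_ne_top]
  refine setLIntegral_congr_fun (isOpen_image_coe_domain_inter D g).measurableSet ?_
  rintro _ ⟨τ, -, rfl⟩
  dsimp only
  rw [det_restrictScalars_toSpanSingleton, abs_of_nonneg (sq_nonneg _), norm_maninConstant_mul_sq]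
  exact (ENNReal.ofReal_mul (by positivity)).symm

end AreaStep

/-! ### Counting: the fibres of `X₀(N) → ℂ/Λ` through the domain, and the lattice tiling -/

section Counting

/-- The extended cardinality of a pairwise disjoint union is the sum of the cardinalities (in
`ℝ≥0∞`, where every family is summable). [folklore] -/
theorem encard_iUnion_of_pairwise_disjoint {ι β : Type*} {t : ι → Set β}
    (h : Pairwise (Disjoint on t)) :
    ((⋃ i, t i).encard : ℝ≥0∞) = ∑' i, ((t i).encard : ℝ≥0∞) :=
  calc ((⋃ i, t i).encard : ℝ≥0∞) = ∑' _x : ↥(⋃ i, t i), (1 : ℝ≥0∞) := (ENNReal.tsum_set_one _).symm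
    _ = ∑' _p : (Σ i, ↥(t i)), (1 : ℝ≥0∞) :=
        ((Set.unionEqSigmaOfDisjoint h).symm.tsum_eq (fun _ ↦ (1 : ℝ≥0∞))).symm
    _ = ∑' i, ((t i).encard : ℝ≥0∞) := by
        rw [ENNReal.tsum_sigma']
        exact tsum_congr fun i ↦ ENNReal.tsum_set_one _

/-- Translating a Lebesgue-null set of `ℂ` by a countable set of vectors and reflecting gives a
null set: `{w | ∃ v ∈ T, v - w ∈ Λ}` is null for `T` null and `Λ` countable. [folklore] -/
theorem volume_setOf_exists_sub_mem_eq_zero {Λ : Set ℂ} (hΛ : Λ.Countable) {T : Set ℂ}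
    (hT : volume T = 0) : volume {w : ℂ | ∃ v ∈ T, v - w ∈ Λ} = 0 := by
  have hsub : {w : ℂ | ∃ v ∈ T, v - w ∈ Λ} ⊆ ⋃ l ∈ Λ, (fun v ↦ v - l) '' T := by
    rintro w ⟨v, hv, hl⟩
    exact mem_iUnion₂.mpr ⟨v - w, hl, v, hv, sub_sub_cancel v w⟩
  refine measure_mono_null hsub ((measure_biUnion_null_iff hΛ).mpr fun l _ ↦ ?_)
  have himg : (fun v : ℂ ↦ v - l) '' T = (fun v ↦ v + l) ⁻¹' T := by
    ext w
    constructor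
    · rintro ⟨v, hv, rfl⟩
      simpa using hv
    · intro hw
      exact ⟨w + l, hw, by simp⟩
  rw [himg, measure_preimage_add_right]
  exact hT

/-- The zero set of a non-zero cusp form is countable (finitely many zeros on each compact set,
`finite_zeros_inter_of_isCompact`, and `ℍ` is σ-compact). [folklore] -/
theorem countable_setOf_cuspForm_eq_zero {Γ : Subgroup (GL (Fin 2) ℝ)} {k : ℤ} (f : CuspForm Γ k)
    (hf : (⇑f : ℍ → ℂ) ≠ 0) : {τ : ℍ | f τ = 0}.Countable := by
  have h : {τ : ℍ | f τ = 0} = ⋃ n, ({τ : ℍ | f τ = 0} ∩ compactCovering ℍ n) := by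
    rw [← inter_iUnion, iUnion_compactCovering, inter_univ]
  rw [h]
  exact countable_iUnion fun n ↦
    (finite_zeros_inter_of_isCompact f.holo' hf (isCompact_compactCovering ℍ n)).countable

variable {N : ℕ} [NeZero N] {W : WeierstrassCurve ℚ} (D : ModularParametrizationData W N)

/-- `Ψ(γτ) - Ψ(τ) ∈ Λ_E` for `γ ∈ Γ₀(N)`: the Eichler integral transforms by periods
(`eichlerIntegral_smul_sub_holds`, Manin 1972 Prop. 1.4) and `c Λ_f ⊆ Λ_E`
(`smul_periodLattice_le`). [folklore] -/
theorem sub_mem_lattice_of_mem_Gamma0 {γ : SL(2, ℤ)} (hγ : γ ∈ Gamma0 N) (τ : ℍ) :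
    (D.c : ℂ) * eichlerIntegral D.f (γ • τ) - (D.c : ℂ) * eichlerIntegral D.f τ ∈ D.L.lattice := by
  rw [← mul_sub, eichlerIntegral_smul_sub_holds D.f ⟨γ, hγ⟩ τ]
  exact D.smul_periodLattice_le _ (cuspSymbol_mem_periodLattice D.f ⟨γ, hγ⟩)

/-- **The degree, read in `ℂ`**: off the (finitely many) exceptional points of `deg_spec`, the
fibre of `Y₀(N) → ℂ/Λ_E → E(ℂ)` over `uniformize w` consists of exactly `deg φ` orbits, i.e.
`#{Γ₀(N)τ : Ψ(τ) ≡ w (mod Λ_E)} = deg φ` (`ker uniformize = Λ_E`). [folklore] -/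
theorem natCard_fiber_eq_deg {w : ℂ}
    (hw : D.uniformize w ∉ {P | Nat.card {y : Y0 N // ∃ τ : ℍ, Y0.mk N τ = y ∧
      D.uniformize ((D.c : ℂ) * eichlerIntegral D.f τ) = P} ≠ D.deg}) :
    Nat.card {y : Y0 N // ∃ τ : ℍ, Y0.mk N τ = y ∧
      (D.c : ℂ) * eichlerIntegral D.f τ - w ∈ D.L.lattice} = D.deg := by
  simp only [mem_setOf_eq, not_not] at hw
  rw [← hw]
  refine Nat.card_congr (Equiv.subtypeEquivRight fun y ↦ ?_)
  refine exists_congr fun τ ↦ and_congr_right fun _ ↦ ?_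
  rw [← D.uniformize_eq_zero_iff, map_sub, sub_eq_zero]

/-- The exceptional set of `deg_spec`, pulled back to `ℂ`, is countable (finitely many cosets of
the countable lattice `Λ_E = ker uniformize`). [folklore] -/
theorem countable_preimage_uniformize {E : Set (W.baseChange ℂ).toAffine.Point} (hE : E.Finite) :
    (D.uniformize ⁻¹' E).Countable := by
  classical
  haveI : Countable D.L.lattice := Countable.of_equiv _ D.L.latticeEquivProd.toEquiv.symm
  choose wP hwP using fun P ↦ D.uniformize_surjective P
  refine Set.Countable.mono (fun x hx ↦ ?_)
    (hE.countable.biUnion fun P _ ↦ Set.countable_range (fun l : D.L.lattice ↦ wP P + (l : ℂ)))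
  have hl : x - wP (D.uniformize x) ∈ D.L.lattice := by
    rw [← D.uniformize_eq_zero_iff, map_sub, hwP, sub_self]
  exact mem_iUnion₂.mpr ⟨D.uniformize x, hx, ⟨x - wP _, hl⟩, add_sub_cancel _ _⟩

variable (g : (↥𝒮ℒ ⧸ (Gamma0 N : Subgroup (GL (Fin 2) ℝ)).subgroupOf 𝒮ℒ) → SL(2, ℤ))
  (hg : ∀ q, (Matrix.SpecialLinearGroup.mapGL ℝ (g q) : GL (Fin 2) ℝ) = ((q.out : ↥𝒮ℒ) : GL (Fin 2) ℝ))

include hg in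
/-- **Orbits versus points of the domain.** If the fibre `{Γ₀(N)τ : Ψ(τ) ≡ w}` has `deg φ` orbits
and no point of it has an `SL(2, ℤ)`-translate on the boundary of `𝒟`, then it meets the domain
`F = ⋃_q g_q⁻¹ 𝒟ᵒ` in exactly `deg φ` points (each orbit exactly once:
`eq_of_smul_eq_of_mem_fdo`, `exists_smul_mem_smul_fdo`). [folklore] -/
theorem encard_fiber_inter_domain_eq_deg {w : ℂ}
    (hdeg : Nat.card {y : Y0 N // ∃ τ : ℍ, Y0.mk N τ = y ∧
      (D.c : ℂ) * eichlerIntegral D.f τ - w ∈ D.L.lattice} = D.deg)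
    (hbnd : ∀ τ : ℍ, (D.c : ℂ) * eichlerIntegral D.f τ - w ∈ D.L.lattice →
      ∀ s : SL(2, ℤ), s • τ ∈ 𝒟 → s • τ ∈ 𝒟ᵒ) :
    ({τ : ℍ | τ ∈ (⋃ q, {τ : ℍ | g q • τ ∈ 𝒟ᵒ}) ∧
      (D.c : ℂ) * eichlerIntegral D.f τ - w ∈ D.L.lattice}.encard : ℝ≥0∞) = D.deg := by
  set A : Set ℍ := {τ : ℍ | τ ∈ (⋃ q, {τ : ℍ | g q • τ ∈ 𝒟ᵒ}) ∧
      (D.c : ℂ) * eichlerIntegral D.f τ - w ∈ D.L.lattice} with hA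
  set T := {y : Y0 N // ∃ τ : ℍ, Y0.mk N τ = y ∧
      (D.c : ℂ) * eichlerIntegral D.f τ - w ∈ D.L.lattice} with hT
  let e : ↥A → T := fun τ ↦ ⟨Y0.mk N τ, τ, rfl, τ.2.2⟩
  have hinj : Injective e := by
    rintro ⟨τ, hτF, hτΛ⟩ ⟨τ', hτF', hτΛ'⟩ h
    have h' : Y0.mk N τ = Y0.mk N τ' := congrArg Subtype.val h
    obtain ⟨γ, hγ⟩ := (Y0.mk_eq_mk_iff N τ τ').mp h'
    obtain ⟨q, hq⟩ := mem_iUnion.mp hτF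
    obtain ⟨r, hr⟩ := mem_iUnion.mp hτF'
    exact Subtype.ext (eq_of_smul_eq_of_mem_fdo g hg hr hq γ.2 hγ).symm
  have hsurj : Surjective e := by
    rintro ⟨y, τ₀, hy, hΛ⟩
    obtain ⟨γ, hγ, q, hq⟩ := exists_smul_mem_smul_fdo g hg (hbnd τ₀ hΛ)
    have hA₁ : γ • τ₀ ∈ A := by
      refine ⟨mem_iUnion.mpr ⟨q, hq⟩, ?_⟩
      have := D.L.lattice.add_mem (sub_mem_lattice_of_mem_Gamma0 D hγ τ₀) hΛ
      rwa [sub_add_sub_cancel] at this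
    refine ⟨⟨γ • τ₀, hA₁⟩, Subtype.ext ?_⟩
    change Y0.mk N (γ • τ₀) = y
    rw [← hy]
    exact (Y0.mk_eq_mk_iff N _ _).mpr ⟨⟨γ, hγ⟩, rfl⟩
  have hcard : Nat.card ↥A = D.deg :=
    (Nat.card_congr (Equiv.ofBijective e ⟨hinj, hsurj⟩)).trans hdeg
  have hfin : A.Finite := by
    have : Finite ↥A := Nat.finite_of_card_ne_zero (hcard ▸ D.deg_pos.ne')
    exact Set.toFinite A
  rw [← hfin.cast_ncard_eq, ENat.toENNReal_coe, ← Nat.card_coe_set_eq, hcard]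

/-- **Lattice tiling.** If a measurable `Nf ≥ 0` on `ℂ` has constant periodisation
`∑_{λ ∈ Λ} Nf(λ + w) = d` for a.e. `w`, then `∫_ℂ Nf = d · covol(Λ)` (integrate over a
fundamental parallelogram, Mathlib `IsAddFundamentalDomain.lintegral_eq_tsum''`,
`ZLattice.covolume_eq_measure_fundamentalDomain`). [folklore] -/
theorem lintegral_eq_mul_covolume_of_tsum_eq (Λ : Submodule ℤ ℂ) [DiscreteTopology Λ]
    [IsZLattice ℝ Λ] [Countable Λ] {Nf : ℂ → ℝ≥0∞} (hNf : Measurable Nf) {d : ℝ≥0∞}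
    (h : ∀ᵐ w : ℂ, ∑' l : Λ, Nf ((l : ℂ) + w) = d) :
    ∫⁻ y, Nf y = d * ENNReal.ofReal (ZLattice.covolume Λ) := by
  have i1 : MeasurableVAdd Λ ℂ := (inferInstance : MeasurableVAdd Λ.toAddSubgroup ℂ)
  have i2 : VAddInvariantMeasure Λ ℂ volume :=
    (inferInstance : VAddInvariantMeasure Λ.toAddSubgroup ℂ volume)
  set b := Module.Free.chooseBasis ℤ Λ
  have hF := ZLattice.isAddFundamentalDomain b (volume : Measure ℂ)
  have hswap := lintegral_tsum
    (μ := volume.restrict (ZSpan.fundamentalDomain (Module.Basis.ofZLatticeBasis ℝ Λ b)))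
    (f := fun (l : Λ) (x : ℂ) ↦ Nf (l +ᵥ x)) fun l ↦
      (hNf.comp (measurable_const_add (l : ℂ))).aemeasurable
  have h' : ∀ᵐ w : ℂ, ∑' l : Λ, Nf (l +ᵥ w) = d := h
  rw [hF.lintegral_eq_tsum'' Nf, ← hswap, lintegral_congr_ae (ae_restrict_of_ae h'), setLIntegral_const,
    ZLattice.covolume_eq_measure_fundamentalDomain Λ volume hF, measureReal_def,
    ENNReal.ofReal_toReal (ZSpan.fundamentalDomain_isBounded _).measure_lt_top.ne]

end Counting

/-! ### Assembly -/

section Assembly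

variable {N : ℕ} [NeZero N] {W : WeierstrassCurve ℚ} (D : ModularParametrizationData W N)
  (g : (↥𝒮ℒ ⧸ (Gamma0 N : Subgroup (GL (Fin 2) ℝ)).subgroupOf 𝒮ℒ) → SL(2, ℤ))
  (hg : ∀ q, (Matrix.SpecialLinearGroup.mapGL ℝ (g q) : GL (Fin 2) ℝ) = ((q.out : ↥𝒮ℒ) : GL (Fin 2) ℝ))

/-- A newform is not the zero function. [folklore] -/
theorem ModularParametrizationData.coe_f_ne_zero : (⇑D.f : ℍ → ℂ) ≠ 0 := fun h ↦
  D.isNewformOf.1.ne_zero (DFunLike.ext' (h.trans rfl))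

include hg in
/-- **The periodised multiplicity is `deg φ` almost everywhere.** For a.e. `w ∈ ℂ`, the points
`z` of `F ∖ {f = 0}` (`F = ⋃_q g_q⁻¹ 𝒟ᵒ`) with `Ψ(z) ≡ w (mod Λ_E)` number exactly `deg φ`:
off three null sets (the cosets of `Λ_E` over the finitely many exceptional points of
`deg_spec`; the `Λ_E`-translates of `Ψ` of the null set of points with a translate on `∂𝒟`;
and of `Ψ` of the countable zero set of `f`) the fibre has `deg φ` orbits
(`natCard_fiber_eq_deg`), each meeting `F` exactly once (`encard_fiber_inter_domain_eq_deg`),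
at a non-zero of `f`. [folklore] -/
theorem ae_tsum_encard_fiber_eq_deg :
    ∀ᵐ w : ℂ, ∑' l : D.L.lattice,
      ((((fun τ : ℍ ↦ (D.c : ℂ) * eichlerIntegral D.f τ) ∘ ofComplex) ⁻¹' {(l : ℂ) + w} ∩
        ((↑) : ℍ → ℂ) '' ((⋃ q, {τ : ℍ | g q • τ ∈ 𝒟ᵒ}) ∩ {τ | D.f τ ≠ 0})).encard : ℝ≥0∞)
      = D.deg := by
  classical
  haveI : Countable D.L.lattice := Countable.of_equiv _ D.L.latticeEquivProd.toEquiv.symm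
  have hΛc : (D.L.lattice : Set ℂ).Countable := Set.countable_coe_iff.mp inferInstance
  set Ψ : ℍ → ℂ := fun τ ↦ (D.c : ℂ) * eichlerIntegral D.f τ with hΨ
  -- the three null sets
  have hbad₁ : volume (D.uniformize ⁻¹' {P | Nat.card {y : Y0 N // ∃ τ : ℍ, Y0.mk N τ = y ∧
      D.uniformize ((D.c : ℂ) * eichlerIntegral D.f τ) = P} ≠ D.deg}) = 0 :=
    (countable_preimage_uniformize D D.deg_spec).measure_zero _
  have hΨdiffC : DifferentiableOn ℂ (Ψ ∘ ofComplex) {z : ℂ | 0 < z.im} := fun z hz ↦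
    (hasDerivAt_maninConstant_mul_eichlerIntegral D hz).differentiableAt.differentiableWithinAt
  have hΨdiff : DifferentiableOn ℝ (Ψ ∘ ofComplex) {z : ℂ | 0 < z.im} :=
    hΨdiffC.restrictScalars ℝ
  have hbad₂ : volume {w : ℂ | ∃ v ∈ Ψ '' {τ : ℍ | ∃ s : SL(2, ℤ), s • τ ∈ 𝒟 \ 𝒟ᵒ},
      v - w ∈ (D.L.lattice : Set ℂ)} = 0 := by
    refine volume_setOf_exists_sub_mem_eq_zero hΛc ?_
    have himg : Ψ '' {τ : ℍ | ∃ s : SL(2, ℤ), s • τ ∈ 𝒟 \ 𝒟ᵒ} =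
        (Ψ ∘ ofComplex) '' (((↑) : ℍ → ℂ) '' {τ : ℍ | ∃ s : SL(2, ℤ), s • τ ∈ 𝒟 \ 𝒟ᵒ}) := by
      rw [image_image]
      exact image_congr fun τ _ ↦ by simp [ofComplex_apply]
    rw [himg]
    refine addHaar_image_eq_zero_of_differentiableOn_of_addHaar_eq_zero volume
      (hΨdiff.mono ?_) (volume_image_coe_eq_zero volume_setOf_exists_smul_mem_fd_diff_fdo)
    rintro _ ⟨τ, -, rfl⟩
    exact τ.im_pos
  have hbad₃ : volume {w : ℂ | ∃ v ∈ Ψ '' {τ : ℍ | D.f τ = 0}, v - w ∈ (D.L.lattice : Set ℂ)} = 0 :=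
    volume_setOf_exists_sub_mem_eq_zero hΛc
      (((countable_setOf_cuspForm_eq_zero D.f D.coe_f_ne_zero).image _).measure_zero _)
  filter_upwards [measure_eq_zero_iff_ae_notMem.mp hbad₁, measure_eq_zero_iff_ae_notMem.mp hbad₂,
    measure_eq_zero_iff_ae_notMem.mp hbad₃] with w hw₁ hw₂ hw₃
  have hdeg := natCard_fiber_eq_deg D hw₁
  have hbnd : ∀ τ : ℍ, Ψ τ - w ∈ D.L.lattice → ∀ s : SL(2, ℤ), s • τ ∈ 𝒟 → s • τ ∈ 𝒟ᵒ := by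
    intro τ hτ s hs
    by_contra hso
    exact hw₂ ⟨_, ⟨τ, ⟨s, hs, hso⟩, rfl⟩, hτ⟩
  have hnz : ∀ τ : ℍ, Ψ τ - w ∈ D.L.lattice → D.f τ ≠ 0 := fun τ hτ hf ↦
    hw₃ ⟨_, ⟨τ, hf, rfl⟩, hτ⟩
  rw [← encard_fiber_inter_domain_eq_deg D g hg hdeg hbnd, ← encard_iUnion_of_pairwise_disjoint]
  · have hset : (⋃ l : D.L.lattice, (Ψ ∘ ofComplex) ⁻¹' {(l : ℂ) + w} ∩
        ((↑) : ℍ → ℂ) '' ((⋃ q, {τ : ℍ | g q • τ ∈ 𝒟ᵒ}) ∩ {τ | D.f τ ≠ 0})) =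
        ((↑) : ℍ → ℂ) '' {τ : ℍ | τ ∈ (⋃ q, {τ : ℍ | g q • τ ∈ 𝒟ᵒ}) ∧
          Ψ τ - w ∈ D.L.lattice} := by
      ext z
      simp only [mem_iUnion, mem_inter_iff, mem_preimage, mem_singleton_iff, Function.comp_apply]
      constructor
      · rintro ⟨l, hzl, τ, ⟨hτF, -⟩, rfl⟩
        refine ⟨τ, ⟨mem_iUnion.mp hτF, ?_⟩, rfl⟩
        rw [ofComplex_apply] at hzl
        rw [hzl, add_sub_cancel_right]
        exact l.2
      · rintro ⟨τ, ⟨hτF, hτΛ⟩, rfl⟩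
        refine ⟨⟨Ψ τ - w, hτΛ⟩, ?_, τ, ⟨mem_iUnion.mpr hτF, hnz τ hτΛ⟩, rfl⟩
        rw [ofComplex_apply, Submodule.coe_mk, sub_add_cancel]
    rw [hset, coe_injective.encard_image]
  · intro l l' hll'
    simp only [Function.onFun]
    refine Set.disjoint_left.mpr fun z hz hz' ↦ hll' ?_
    have h1 : (Ψ ∘ ofComplex) z = (l : ℂ) + w := hz.1
    have h2 : (Ψ ∘ ofComplex) z = (l' : ℂ) + w := hz'.1
    exact Subtype.ext (add_right_cancel (h1.symm.trans h2))

include hg in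
/-- **Zagier's degree formula** (Zagier, *Modular parametrizations of elliptic curves*, Canad.
Math. Bull. 28 (1985), §1, p. 374): for a modular parametrisation `φ : X₀(N) → E(ℂ) = ℂ/Λ_E`,
`φ(τ) = uniformize (c · 2πi ∫_{i∞}^τ f)`, pulling back `dx dy` gives
`‖c f‖² = ∬_{Γ₀(N)∖ℍ} |c f|² du dv = (1/4π²) ∬ φ^*(dx dy) = (1/4π²) · deg(φ) · Vol(E)`, i.e.
`4π² c² (f, f)_{Γ₀(N)} = deg(φ) · covol(Λ_E)`. Discharge of the named fact
`ModularParametrizationData.zagier_degree_formula` (`ModularDegreeFormula.lean`), in its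
normalisation: `(f, f) = peterssonProduct (Gamma0 N) 2 f f` (integral over the coset translates
of `𝒟` against `dx dy / y²`, no volume factor), `deg(φ) = D.deg` (generic number of
`Γ₀(N)`-orbits in a fibre, `deg_spec`), `covol(Λ_E) = ZLattice.covolume D.L.lattice`.

Proof: (1) `(f, f) = ∫⁻_F |f|² dx dy` for the fundamental domain `F = ⋃_q g_q⁻¹ 𝒟ᵒ` of `Γ₀(N)`
(`peterssonProduct_self_eq_lintegral`, `lintegral_fd_sum_eq_lintegral_domain`,
`lintegral_domain_eq_lintegral_image`); (2) the area formula with multiplicity for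
`Ψ = c · 2πi ∫ f` (`|Ψ'|² = 4π²c²|f|²`) on `F ∖ {f = 0}`:
`4π²c² ∫_F |f|² = ∫_ℂ #{z ∈ F ∖ {f=0} : Ψ z = y} dy` (`lintegral_domain_eq_lintegral_encard`);
(3) tiling `ℂ` by `Λ_E`: the integrand periodises to the number of points of `F` over
`y mod Λ_E`, which is `deg φ` for a.e. `y` (`ae_tsum_encard_fiber_eq_deg`), so the integral is
`deg φ · covol(Λ_E)` (`lintegral_eq_mul_covolume_of_tsum_eq`).
[cite: ZagierCMB1985, §1, p. 374] -/
theorem zagier_degree_formula_of_cosetReps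
    [Fintype (↥𝒮ℒ ⧸ (Gamma0 N : Subgroup (GL (Fin 2) ℝ)).subgroupOf 𝒮ℒ)] : D.zagier_degree_formula := by
  classical
  haveI : Countable D.L.lattice := Countable.of_equiv _ D.L.latticeEquivProd.toEquiv.symm
  have hFo : MeasurableSet (⋃ q, {τ : ℍ | g q • τ ∈ 𝒟ᵒ}) :=
    (isOpen_iUnion_setOf_smul_mem_fdo g).measurableSet
  have hUm := (isOpen_image_coe_domain_inter D g).measurableSet
  -- (1) the Petersson norm as an integral over `F ⊆ ℂ`
  have hA : peterssonProduct (Gamma0 N) 2 D.f D.f =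
      ((∫⁻ z in ((↑) : ℍ → ℂ) '' (⋃ q, {τ : ℍ | g q • τ ∈ 𝒟ᵒ}),
        ENNReal.ofReal (‖D.f (ofComplex z)‖ ^ 2)).toReal : ℂ) := by
    rw [peterssonProduct_self_eq_lintegral g hg, lintegral_fd_sum_eq_lintegral_domain g hg,
      lintegral_domain_eq_lintegral_image hFo]
  -- (1') the zeros of `f` do not contribute
  have hB : ∫⁻ z in ((↑) : ℍ → ℂ) '' (⋃ q, {τ : ℍ | g q • τ ∈ 𝒟ᵒ}),
        ENNReal.ofReal (‖D.f (ofComplex z)‖ ^ 2) =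
      ∫⁻ z in ((↑) : ℍ → ℂ) '' ((⋃ q, {τ : ℍ | g q • τ ∈ 𝒟ᵒ}) ∩ {τ | D.f τ ≠ 0}),
        ENNReal.ofReal (‖D.f (ofComplex z)‖ ^ 2) := by
    symm
    have hsub : ((↑) : ℍ → ℂ) '' ((⋃ q, {τ : ℍ | g q • τ ∈ 𝒟ᵒ}) ∩ {τ | D.f τ ≠ 0}) ⊆
        ((↑) : ℍ → ℂ) '' (⋃ q, {τ : ℍ | g q • τ ∈ 𝒟ᵒ}) := image_mono inter_subset_left
    rw [← inter_eq_self_of_subset_left hsub, ← Measure.restrict_restrict hUm,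
      ← lintegral_indicator hUm]
    refine setLIntegral_congr_fun (measurableEmbedding_coe.measurableSet_image.mpr hFo) ?_
    rintro _ ⟨τ, hτ, rfl⟩
    dsimp only
    by_cases hf : D.f τ = 0
    · rw [indicator_of_notMem, ofComplex_apply, hf, norm_zero, zero_pow two_ne_zero,
        ENNReal.ofReal_zero]
      intro hmem
      exact ((coe_injective.mem_set_image).mp hmem).2 hf
    · rw [indicator_of_mem]
      exact ⟨τ, ⟨hτ, hf⟩, rfl⟩
  -- (2) area formula, (3) tiling
  have hC := lintegral_domain_eq_lintegral_encard D g
  have hD := lintegral_eq_mul_covolume_of_tsum_eq D.L.lattice (measurable_encard_fiber D g)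
    (ae_tsum_encard_fiber_eq_deg D g hg)
  have hE : ENNReal.ofReal (4 * Real.pi ^ 2 * (D.c : ℝ) ^ 2) *
      ∫⁻ z in ((↑) : ℍ → ℂ) '' (⋃ q, {τ : ℍ | g q • τ ∈ 𝒟ᵒ}),
        ENNReal.ofReal (‖D.f (ofComplex z)‖ ^ 2) =
      D.deg * ENNReal.ofReal (ZLattice.covolume D.L.lattice) := by
    rw [hB, hC, hD]
  -- back to `ℝ` and `ℂ`
  have hR := congrArg ENNReal.toReal hE
  rw [ENNReal.toReal_mul, ENNReal.toReal_ofReal (by positivity), ENNReal.toReal_mul,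
    ENNReal.toReal_natCast, ENNReal.toReal_ofReal (ZLattice.covolume_pos _ _).le] at hR
  unfold ModularParametrizationData.zagier_degree_formula
  rw [hA, ← Complex.ofReal_mul, hR]

end Assembly

section Discharge

variable {N : ℕ} [NeZero N] {W : WeierstrassCurve ℚ} (D : ModularParametrizationData W N)

/-- **Zagier's degree formula `4π² c² (f, f) = deg(φ) · covol(Λ_E)`** — discharge of the named
fact `ModularParametrizationData.zagier_degree_formula` for every modular parametrisation datum
(Zagier 1985, §1, p. 374: "`‖f‖² = ∬_{Γ∖ℍ} |f|² du dv = (1/4π²) deg(φ) Vol(E)`", with Zagier's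
`f` our `c · f`). See `zagier_degree_formula_of_cosetReps` for the proof.
[cite: ZagierCMB1985, §1, p. 374] -/
theorem ModularParametrizationData.zagier_degree_formula_holds : D.zagier_degree_formula := by
  obtain ⟨g, hg⟩ := exists_mapGL_eq_out (N := N)
  letI : Fintype (↥𝒮ℒ ⧸ (Gamma0 N : Subgroup (GL (Fin 2) ℝ)).subgroupOf 𝒮ℒ) := Fintype.ofFinite _
  exact zagier_degree_formula_of_cosetReps D g hg

end Discharge

end Literature.NumberTheory.EllipticCurves.ModularForms

end
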